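import Summits.SmoothPoincare4.SmoothPoincare4.Theses.SblfDescent
import Summits.SmoothPoincare4.SmoothPoincare4.Theorems.SblfDescentStepTwoStubSblfTransport
import Summits.SmoothPoincare4.SmoothPoincare4.Theorems.SblfDescentRungOne
import Literature.Topology.FourManifolds.GenusOneSblfOnSphereFour
import Literature.Topology.FourManifolds.SimplifiedBrokenLefschetzExistence

/-!
# SmoothPoincare4 / SblfDescent — crux `StepTwo`, line `Sketch`: the Reduction (both directions)

Crux item stmt-SmoothPoincare4-18529, route decl
`Summit.SmoothPoincare4.SmoothPoincare4.Theses.SblfDescent.StepTwo` (for every smooth `M ≃ₕ S⁴`,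
`HAS(M, 1) → HAS(M, 0)`: a simplified broken Lefschetz fibration of lower genus `1` can be traded for one
of lower genus `0`).  Line `Sketch` reduces the crux to its APEX stub `stub_genusTwoRecognition`
("a smooth homotopy 4-sphere carrying a genus-2 SBLF is diffeomorphic to `S⁴`") plus published facts.
This file is the sorry-free composition layer of the registered skeleton `Cruxes/StepTwo/Lines/Sketch.lean`:

* `helper_stepTwo_of_genusTwoRecognition` (registered helper of the crux item): APEX → ADK's genus-one
  fibration of `S⁴` (the named fact `exists_sblf_genus_one_noLefschetz_sphere_four`) → `StepTwo`, through
  the LANDED transport of SBLF structures along diffeomorphisms (`stub_sblfTransport`, p148441);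
* `stepTwo_of_genusTwoRecognition_of_everyGenus`: the same with Baykur 2012, Thm. 18 + Lemma 12
  (`sblf_of_every_genus_of_diffeomorph_sphere_four`, which has transport built in) in place of ADK;
* the CONVERSE `genusTwoRecognition_of_stepTwo_of_rungOne`: `StepTwo` together with the route's genus-one
  rung `RungOne` (Hayano 2011 / Baykur–Kamada 2015, proved in `SblfDescentRungOne.lean` modulo the named
  fact `nonempty_diffeomorph_sphere_four_of_sblf_genus_one`) gives the apex back; hence
* `stepTwo_iff_genusTwoRecognition`: modulo the two PUBLISHED facts (ADK existence on `S⁴`, Hayano's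
  genus-one classification) the crux `StepTwo` is EQUIVALENT to genus-two recognition on homotopy
  4-spheres — the open sub-classification "homotopy 4-spheres of broken genus `≤ 2` are standard"
  (Baykur–Saeki 2018, §6; the refuter's `stepTwo_iff_slice` in `Cruxes/StepTwo/Disproof.lean`, here on
  the positive side over the Literature structure `IsSimplifiedBrokenLefschetzFibration`).

Everything here is pure logic over the route file, the Literature structure and the landed transport.
-/

-- the prescribed namespace `Summit.<P>.<Sub>.…` duplicates `SmoothPoincare4` (P = Sub)
set_option linter.dupNamespace false

namespace Summit.SmoothPoincare4.SmoothPoincare4.Theorems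

open scoped Manifold ContDiff Topology ContinuousMap
open Literature.Topology.FourManifolds

/-- **The ADK stub from the named fact.**  The registered stub `stub_adkGenusOneSphere` of line Sketch
(`∃ o f L, IsSimplifiedBrokenLefschetzFibration o f L 0` on the unit sphere `S⁴ ⊆ ℝ⁵`) follows from the
named Literature fact `exists_sblf_genus_one_noLefschetz_sphere_four` (Auroux–Donaldson–Katzarkov 2005,
§8.2 Ex. 1: `∃ o f, IsSimplifiedBrokenLefschetzFibration o f ∅ 0`) by taking `L = ∅`.
CONDITIONAL on that fact. [cite: AurouxDonaldsonKatzarkov2005, §8.2 Example 1] -/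
theorem stub_adkGenusOneSphere_of_fact (hADK : exists_sblf_genus_one_noLefschetz_sphere_four) :
    ∃ (o : SmoothOrientation (𝓡 4) (Metric.sphere (0 : EuclideanSpace ℝ (Fin 5)) 1))
      (f : Metric.sphere (0 : EuclideanSpace ℝ (Fin 5)) 1 →
        Metric.sphere (0 : EuclideanSpace ℝ (Fin 3)) 1)
      (L : Finset (Metric.sphere (0 : EuclideanSpace ℝ (Fin 5)) 1)),
      IsSimplifiedBrokenLefschetzFibration o f L 0 := by
  obtain ⟨o, f, hf⟩ := hADK
  exact ⟨o, f, ∅, hf⟩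

/-- **Registered helper `helper_stepTwo_of_genusTwoRecognition` (arrow form of the line-Sketch
composition).**  GIVEN genus-two recognition on homotopy 4-spheres (the apex stub, as a hypothesis) and
ADK's genus-one fibration of `S⁴` (the named fact `exists_sblf_genus_one_noLefschetz_sphere_four`), the
crux `StepTwo` holds: unpack the route's inline `HAS(M, 1)` into
`IsSimplifiedBrokenLefschetzFibration o f L 1`, recognise `M ≅ S⁴`, transport ADK's fibration back to `M`
along the diffeomorphism (`stub_sblfTransport`, landed), and repack into the inline `HAS(M, 0)`.
CONDITIONAL on both hypotheses; the first is the open apex. [folklore] -/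
theorem helper_stepTwo_of_genusTwoRecognition :
    (∀ (X : Type) [TopologicalSpace X] [T2Space X] [SecondCountableTopology X]
      [ChartedSpace (EuclideanSpace ℝ (Fin 4)) X] [IsManifold (𝓡 4) ((⊤ : ℕ∞) : WithTop ℕ∞) X],
      X ≃ₕ Metric.sphere (0 : EuclideanSpace ℝ (Fin 5)) 1 →
      (∃ (o : Literature.Topology.FourManifolds.SmoothOrientation (𝓡 4) X)
          (f : X → Metric.sphere (0 : EuclideanSpace ℝ (Fin 3)) 1) (L : Finset X),
          Literature.Topology.FourManifolds.IsSimplifiedBrokenLefschetzFibration o f L 1) →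
      Nonempty (Diffeomorph (𝓡 4) (𝓡 4) X (Metric.sphere (0 : EuclideanSpace ℝ (Fin 5)) 1)
        ((⊤ : ℕ∞) : WithTop ℕ∞))) →
    Literature.Topology.FourManifolds.exists_sblf_genus_one_noLefschetz_sphere_four →
    Summit.SmoothPoincare4.SmoothPoincare4.Theses.SblfDescent.StepTwo := by
  intro hR hADK M _ _ _ _ _ e hM
  obtain ⟨o, f, L, h1, h2, h3, h4, h5, h6, h7, h8, h9, h10⟩ := hM
  have hS : IsSimplifiedBrokenLefschetzFibration o f L 1 := ⟨h1, h2, h3, h4, h5, h6, h7, h8, h9, h10⟩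
  obtain ⟨Φ⟩ := hR M e ⟨o, f, L, hS⟩
  obtain ⟨o', f', L', g1, g2, g3, g4, g5, g6, g7, g8, g9, g10⟩ :=
    stub_sblfTransport M (Metric.sphere (0 : EuclideanSpace ℝ (Fin 5)) 1) 0 ⟨Φ⟩
      (stub_adkGenusOneSphere_of_fact hADK)
  exact ⟨o', f', L', g1, g2, g3, g4, g5, g6, g7, g8, g9, g10⟩

/-- **`StepTwo` from recognition and Baykur's every-genus fact.**  Variant of
`helper_stepTwo_of_genusTwoRecognition` with Baykur 2012, Thm. 18 + Lemma 12
(`sblf_of_every_genus_of_diffeomorph_sphere_four`: every 4-manifold diffeomorphic to `S⁴` carries SBLFs of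
every lower genus — transport built in) in place of ADK + transport: recognise `M ≅ S⁴`, take the
genus-one (`h = 0`) fibration, repack.  CONDITIONAL on the apex and on that fact.
[cite: Baykur2012, Thm. 18 and Lemma 12] -/
theorem stepTwo_of_genusTwoRecognition_of_everyGenus
    (hR : ∀ (X : Type) [TopologicalSpace X] [T2Space X] [SecondCountableTopology X]
      [ChartedSpace (EuclideanSpace ℝ (Fin 4)) X] [IsManifold (𝓡 4) ((⊤ : ℕ∞) : WithTop ℕ∞) X],
      X ≃ₕ Metric.sphere (0 : EuclideanSpace ℝ (Fin 5)) 1 →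
      (∃ (o : Literature.Topology.FourManifolds.SmoothOrientation (𝓡 4) X)
          (f : X → Metric.sphere (0 : EuclideanSpace ℝ (Fin 3)) 1) (L : Finset X),
          Literature.Topology.FourManifolds.IsSimplifiedBrokenLefschetzFibration o f L 1) →
      Nonempty (Diffeomorph (𝓡 4) (𝓡 4) X (Metric.sphere (0 : EuclideanSpace ℝ (Fin 5)) 1)
        ((⊤ : ℕ∞) : WithTop ℕ∞)))
    (hB : sblf_of_every_genus_of_diffeomorph_sphere_four) :
    Summit.SmoothPoincare4.SmoothPoincare4.Theses.SblfDescent.StepTwo := by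
  intro M _ _ _ _ _ e hM
  obtain ⟨o, f, L, h1, h2, h3, h4, h5, h6, h7, h8, h9, h10⟩ := hM
  have hS : IsSimplifiedBrokenLefschetzFibration o f L 1 := ⟨h1, h2, h3, h4, h5, h6, h7, h8, h9, h10⟩
  obtain ⟨o', f', L', g1, g2, g3, g4, g5, g6, g7, g8, g9, g10⟩ := hB M (hR M e ⟨o, f, L, hS⟩) 0
  exact ⟨o', f', L', g1, g2, g3, g4, g5, g6, g7, g8, g9, g10⟩

/-- **Converse: the apex from `StepTwo` and the genus-one rung.**  If the crux `StepTwo` and the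
route's support `RungOne` (a homotopy 4-sphere with a genus-1 SBLF is `≅ S⁴`; Hayano 2011, Cor. 4.11 /
Baykur–Kamada 2015, Lemma 11 — proved modulo the named fact in `SblfDescentRungOne.lean`) both hold,
then so does genus-two recognition: pack the genus-2 SBLF into the inline `HAS(M, 1)`, descend to
`HAS(M, 0)` by `StepTwo`, recognise by `RungOne`.  So the apex of line Sketch is NECESSARY for the crux
given the (published) genus-one rung: no line under `StepTwo` avoids it. [folklore] -/
theorem genusTwoRecognition_of_stepTwo_of_rungOne
    (h2 : Summit.SmoothPoincare4.SmoothPoincare4.Theses.SblfDescent.StepTwo)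
    (h1 : Summit.SmoothPoincare4.SmoothPoincare4.Theses.SblfDescent.RungOne) :
    ∀ (X : Type) [TopologicalSpace X] [T2Space X] [SecondCountableTopology X]
      [ChartedSpace (EuclideanSpace ℝ (Fin 4)) X] [IsManifold (𝓡 4) ((⊤ : ℕ∞) : WithTop ℕ∞) X],
      X ≃ₕ Metric.sphere (0 : EuclideanSpace ℝ (Fin 5)) 1 →
      (∃ (o : Literature.Topology.FourManifolds.SmoothOrientation (𝓡 4) X)
          (f : X → Metric.sphere (0 : EuclideanSpace ℝ (Fin 3)) 1) (L : Finset X),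
          Literature.Topology.FourManifolds.IsSimplifiedBrokenLefschetzFibration o f L 1) →
      Nonempty (Diffeomorph (𝓡 4) (𝓡 4) X (Metric.sphere (0 : EuclideanSpace ℝ (Fin 5)) 1)
        ((⊤ : ℕ∞) : WithTop ℕ∞)) := by
  intro X _ _ _ _ _ e hX
  obtain ⟨o, f, L, ⟨h1', h2', h3, h4, h5, h6, h7, h8, h9, h10⟩⟩ := hX
  exact h1 X e (h2 X e ⟨o, f, L, h1', h2', h3, h4, h5, h6, h7, h8, h9, h10⟩)

/-- **Converse, modulo Hayano's published genus-one classification.**  GIVEN the named fact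
`nonempty_diffeomorph_sphere_four_of_sblf_genus_one` (Hayano 2011, Cor. 4.11 at `Q_X = 0`;
Baykur–Kamada 2015, Lemma 11 + Cor. 14), `StepTwo` implies genus-two recognition on homotopy 4-spheres
(`genusTwoRecognition_of_stepTwo_of_rungOne` with `RungOne_of_sblfGenusOne`).  CONDITIONAL on the fact.
[cite: Hayano2011, Cor. 4.11] -/
theorem genusTwoRecognition_of_stepTwo
    (hH : nonempty_diffeomorph_sphere_four_of_sblf_genus_one)
    (h2 : Summit.SmoothPoincare4.SmoothPoincare4.Theses.SblfDescent.StepTwo) :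
    ∀ (X : Type) [TopologicalSpace X] [T2Space X] [SecondCountableTopology X]
      [ChartedSpace (EuclideanSpace ℝ (Fin 4)) X] [IsManifold (𝓡 4) ((⊤ : ℕ∞) : WithTop ℕ∞) X],
      X ≃ₕ Metric.sphere (0 : EuclideanSpace ℝ (Fin 5)) 1 →
      (∃ (o : Literature.Topology.FourManifolds.SmoothOrientation (𝓡 4) X)
          (f : X → Metric.sphere (0 : EuclideanSpace ℝ (Fin 3)) 1) (L : Finset X),
          Literature.Topology.FourManifolds.IsSimplifiedBrokenLefschetzFibration o f L 1) →
      Nonempty (Diffeomorph (𝓡 4) (𝓡 4) X (Metric.sphere (0 : EuclideanSpace ℝ (Fin 5)) 1)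
        ((⊤ : ℕ∞) : WithTop ℕ∞)) :=
  genusTwoRecognition_of_stepTwo_of_rungOne h2 (RungOne_of_sblfGenusOne hH)

/-- **`StepTwo` ⟺ genus-two recognition, modulo two published facts.**  GIVEN ADK's genus-one
fibration of `S⁴` (`exists_sblf_genus_one_noLefschetz_sphere_four`, Auroux–Donaldson–Katzarkov 2005 §8.2
Ex. 1) and Hayano's genus-one classification (`nonempty_diffeomorph_sphere_four_of_sblf_genus_one`,
Hayano 2011 Cor. 4.11 / Baykur–Kamada 2015 Lemma 11), the crux `StepTwo` of route SblfDescent holds iff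
every smooth homotopy 4-sphere admitting a genus-2 simplified broken Lefschetz fibration (lower genus
`1`) is diffeomorphic to `S⁴` — the apex stub `stub_genusTwoRecognition` of line Sketch.  This is the
positive-side, Literature-vocabulary form of the refuter's `stepTwo_iff_slice`
(`Cruxes/StepTwo/Disproof.lean`): the crux IS the open sub-classification "homotopy 4-spheres of broken
genus `≤ 2` are standard" (not in print: Baykur–Saeki 2018, §6).  CONDITIONAL on the two facts.
[cite: Hayano2011, Cor. 4.11] -/
theorem stepTwo_iff_genusTwoRecognition
    (hADK : exists_sblf_genus_one_noLefschetz_sphere_four)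
    (hH : nonempty_diffeomorph_sphere_four_of_sblf_genus_one) :
    Summit.SmoothPoincare4.SmoothPoincare4.Theses.SblfDescent.StepTwo ↔
    ∀ (X : Type) [TopologicalSpace X] [T2Space X] [SecondCountableTopology X]
      [ChartedSpace (EuclideanSpace ℝ (Fin 4)) X] [IsManifold (𝓡 4) ((⊤ : ℕ∞) : WithTop ℕ∞) X],
      X ≃ₕ Metric.sphere (0 : EuclideanSpace ℝ (Fin 5)) 1 →
      (∃ (o : Literature.Topology.FourManifolds.SmoothOrientation (𝓡 4) X)
          (f : X → Metric.sphere (0 : EuclideanSpace ℝ (Fin 3)) 1) (L : Finset X),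
          Literature.Topology.FourManifolds.IsSimplifiedBrokenLefschetzFibration o f L 1) →
      Nonempty (Diffeomorph (𝓡 4) (𝓡 4) X (Metric.sphere (0 : EuclideanSpace ℝ (Fin 5)) 1)
        ((⊤ : ℕ∞) : WithTop ℕ∞)) :=
  ⟨genusTwoRecognition_of_stepTwo hH, fun hR => helper_stepTwo_of_genusTwoRecognition hR hADK⟩

end Summit.SmoothPoincare4.SmoothPoincare4.Theorems
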